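import Summits.AtomisticToContinuum.HydrodynamicLimit.Theorems.RelayRaceLocalityNearConstantShortTimeHLGronwallReduction
import Summits.AtomisticToContinuum.HydrodynamicLimit.Theorems.RelayRaceLocalityNearConstantShortTimeHLExpTailDefs
import Summits.AtomisticToContinuum.HydrodynamicLimit.Theorems.RelayRaceLocalityNearConstantShortTimeHLExpCapDefs
import Summits.AtomisticToContinuum.HydrodynamicLimit.Theorems.RelayRaceLocalityNearConstantShortTimeHLIntExpMarkov
import HarnessLib

/-!
# Crux `NearConstantShortTimeHL` (stmt-AtomisticToContinuum-12502), line `small-tilt-domination`, skeleton v24 (lead c9):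
# `stub_reductionPX` — level 0 of the Grönwall assembly UNDER THE INTEGRATED EXPONENTIAL CAP (instead of the integrated quartic cap)

Support file (`--supports stmt-AtomisticToContinuum-12502`). Skeleton v24 RE-TYPES the equilibrium closure K-stubs after wave 1 of lead c9
priced S3⁗ `EnergyClosureTightnessPQ` (packing cap + integrated QUARTIC cap, no speed cap) as physics-false (transient giant-driver Newton
cradles): the K-stubs S2⁵/S3⁵ `MomentumClosureTightnessPX` / `EnergyClosureTightnessPX` (`…ExpCapDefs`) condition on the ball-packing cap and
the integrated EXPONENTIAL cap `intExpCapOn Φ z S K := ∫⁻ r in S, ofReal (n⁻¹ Σᵢ exp ‖vᵢ(r)‖) ≤ ofReal K`, and the dynamic theorem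
`DynamicTheoremPX` is `DynamicTheoremPE` with the cap-failure hypothesis re-typed to `hcapX : ∀ K > 0, ∀ᶠ N, P_N {K < ∫₀ᵗ n⁻¹ Σᵢ e^{‖vᵢ(r)‖} dr}
≤ C₄ / K` and `intExpCapOn` in the events of `hKmom` / `hKen`. This file is level 0 of the assembly in that currency: the landed
`stub_reductionPE` (`…ReductionPE`, p157079) VERBATIM — thresholds, `M`-box, import constant, `δ₀`, reference state, activity inversion (S5a),
identification, LDA at `0`, St3, bookkeeping, St2′ along the solution, packing cap, event import `P_N ≤ e^{Cδn} G_N`, K-stub rates at `M′`, the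
family of exponential moments `hexpm` — with exactly two touch points: (i) the K-stub hypotheses are S2⁵/S3⁵ (same quantifier shape as S2⁗/S3⁗,
only the cap in the event differs, so the threshold bookkeeping is textual); (ii) the integrated-EXPONENTIAL-cap failure bound `hcapX` handed to
the dynamic theorem is `intExpMoment_markov` (`…IntExpMarkov`: Tonelli along the jointly measurable flow, Markov) applied to conjunct (c″) of
`TrueLawCapsPE` at the rate `b = 1` (`one_mul`), with `C₄ := t max(A₁, 0)`.
References: H.-T. Yau, Lett. Math. Phys. 22 (1991) §2; B. Nachtergaele – H.-T. Yau, Comm. Math. Phys. 243 (2003) §7.2; S. Olla – S.R.S.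
Varadhan – H.-T. Yau, Comm. Math. Phys. 155 (1993) §3.
-/

noncomputable section

namespace Summit.AtomisticToContinuum.HydrodynamicLimit.Theorems.NearConstantShortTimeHL

open scoped BigOperators ENNReal Topology
open MeasureTheory Set Filter
open Literature.MathematicalPhysics.KineticTheory Literature.Analysis.FluidPDE Literature.Analysis.FunctionSpaces

open scoped Real
open Real (exp log)
open ENNReal (ofReal)

/-- **Level 0 under the integrated exponential cap (`stub_reductionPX`, registered stub of skeleton v24; verbatim `stub_reductionPE` with
S2⁵ `MomentumClosureTightnessPX`, S3⁵ `EnergyClosureTightnessPX` and `DynamicTheoremPX`): thresholds, activity inversion, identification, and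
the reduction of `OneMeanLowerBound` to the dynamic theorem `DynamicTheoremPX` at fixed data**, from St2′, St3, S5a, S1 and the inputs S2⁵, S3⁵,
S4‴ `TrueLawCapsPE` — the integrated-exponential-cap failure bound `hcapX` is `intExpMoment_markov` applied to the FIRST exponential velocity
moment in mean (c″, `b = 1`), and the whole family (c″) is passed through as `hexpm`. The landed `stub_reductionPE` verbatim otherwise.
[cite: Yau1991, §2] -/
theorem stub_reductionPX : DynamicTheoremPX → MesoscaleSuperlinearityE → UniformPressureAlongSolution → GeneralFamilyStaticLLN → TiltDomination → MomentumClosureTightnessPX → EnergyClosureTightnessPX → TrueLawCapsPE → OneMeanLowerBound := by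
  intro hdyn hSt2 hSt3 hS5a hTD hS2 hS3 hS4
  -- (A) universal thresholds: the cap level `ηP` and the crux threshold `η₀`
  obtain ⟨ηE, hηE, F, hFa, hEqF, hF0, -, -⟩ := hsEosLowDensity_proof
  obtain ⟨ηS, hηS, HSt2⟩ := hSt2
  obtain ⟨η3p, hη3p, HSt3⟩ := hSt3
  obtain ⟨ηK2, hηK2, HS2⟩ := hS2
  obtain ⟨ηK3, hηK3, HS3⟩ := hS3
  obtain ⟨ηL, hηL, HL⟩ := stub_ldaGeneralFamilies
  -- `G = F + id · F′` (so that `g_σ(a) = G(aσ³)` in the band) is continuous at `0`, `G 0 = 0`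
  have h0E : (0 : ℝ) ∈ Ioo (-ηE) ηE := ⟨by linarith, hηE⟩
  have hGc : ContinuousAt (fun η => F η + η * deriv F η) 0 :=
    ((hFa 0 h0E).fun_add (analyticAt_id.fun_mul (hFa.deriv 0 h0E))).continuousAt
  set ηP : ℝ := min (min ηK2 ηK3) (ηE / 2) with hηPdef
  have hηP : 0 < ηP := lt_min (lt_min hηK2 hηK3) (by positivity)
  obtain ⟨hηPK2, hηPK3, hηPE2⟩ : ηP ≤ ηK2 ∧ ηP ≤ ηK3 ∧ ηP ≤ ηE / 2 :=
    ⟨(min_le_left _ _).trans (min_le_left _ _), (min_le_left _ _).trans (min_le_right _ _), min_le_right _ _⟩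
  set η₀ : ℝ := min (ηP / 2) (min (min ηS η3p) ηL) with hη₀def
  have hη₀ : 0 < η₀ := lt_min (by positivity) (lt_min (lt_min hηS hη3p) hηL)
  obtain ⟨hη₀P2, hη₀S, hη₀3, hη₀L⟩ : η₀ ≤ ηP / 2 ∧ η₀ ≤ ηS ∧ η₀ ≤ η3p ∧ η₀ ≤ ηL :=
    ⟨min_le_left _ _, (min_le_right _ _).trans ((min_le_left _ _).trans (min_le_left _ _)),
      (min_le_right _ _).trans ((min_le_left _ _).trans (min_le_right _ _)), (min_le_right _ _).trans (min_le_right _ _)⟩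
  have hηPE : ηP < ηE := by linarith
  have hη₀E : η₀ ≤ ηE := by linarith
  refine ⟨η₀, hη₀, fun M hM => ?_⟩
  -- (B) given `M`: w.l.o.g. `1 ≤ M`; the box `M'`, the import constant, the K-stub rates, `δ₀`, `δ`, `ηG`, `τ₀ = 1`
  by_cases hM1 : 1 ≤ M
  swap
  · -- for `M < 1` the temperature guard `M⁻¹ ≤ θ 0 x ≤ M` is contradictory: any witnesses do
    refine ⟨1, one_pos, 1, one_pos, fun a₀ θ₀ u₀ _ _ _ _ _ => ⟨1, one_pos, ?_⟩⟩
    intro σ _ _ ε n _ _ _ T ρ θ u _ _ Φ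
    dsimp only
    intro _ _ t ht hg
    have h := hg 0 ⟨le_rfl, ht.1⟩ (0 : T3)
    have h2 : 1 < M⁻¹ := (one_lt_inv₀ hM).2 (not_le.1 hM1)
    linarith [h.2.2.1.trans h.2.1, not_le.1 hM1]
  have hMi1 : M⁻¹ ≤ 1 := inv_le_one_of_one_le₀ hM1
  set M' : ℝ := 2 * M + 2 with hM'def
  obtain ⟨hM'4, hM'1, hMM'⟩ : 4 ≤ M' ∧ 1 ≤ M' ∧ M ≤ M' := ⟨by linarith [hM'def], by linarith [hM'def], by linarith [hM'def]⟩
  have hM'i1 : M'⁻¹ ≤ 1 := inv_le_one_of_one_le₀ hM'1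
  have hM'iM : M'⁻¹ ≤ M⁻¹ := inv_anti₀ hM hMM'
  obtain ⟨C, hC, HTD⟩ := eventImport_of_tiltDomination hTD hM'1
  -- the K-stub rates at the box `M'` (uniform in the cap level)
  obtain ⟨c₂, hc₂, HS2M⟩ := HS2 M' hM'1
  obtain ⟨c₃, hc₃, HS3M⟩ := HS3 M' hM'1
  set c₀ : ℝ := min c₂ c₃ with hc₀def
  obtain ⟨hc₀, hc₀2, hc₀3⟩ : 0 < c₀ ∧ c₀ ≤ c₂ ∧ c₀ ≤ c₃ := ⟨lt_min hc₂ hc₃, min_le_left _ _, min_le_right _ _⟩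
  set K : ℝ := 4 * M + 4 with hKdef
  have hK8 : 8 ≤ K := by linarith [hKdef]
  have hK : 0 < K := by linarith
  set δ₀ : ℝ := min (1 / (8 * K)) (c₀ / (8 * C * K)) with hδ₀def
  have hδ₀ : 0 < δ₀ := lt_min (by positivity) (by positivity)
  obtain ⟨ηG, hηG, HG⟩ := Metric.continuousAt_iff.1 hGc δ₀ hδ₀
  set δ : ℝ := K * δ₀ with hδdef
  have hδ : 0 < δ := mul_pos hK hδ₀
  have hδ8 : δ ≤ 1 / 8 := by
    calc K * δ₀ ≤ K * (1 / (8 * K)) := mul_le_mul_of_nonneg_left (min_le_left _ _) hK.le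
      _ = 1 / 8 := by field_simp [hK.ne']
  have hδhalf : δ ≤ 1 / 2 := by linarith
  have h3δ₀ : 3 * δ₀ ≤ δ := by rw [hδdef]; exact mul_le_mul_of_nonneg_right (by linarith only [hK8]) hδ₀.le
  have hδ₀half : δ₀ ≤ 1 / 2 := by linarith
  have hCδ : C * δ < c₀ := by
    calc C * (K * δ₀) ≤ C * (K * (c₀ / (8 * C * K))) := by gcongr; exact min_le_right _ _
      _ = c₀ / 8 := by field_simp [hC.ne', hK.ne']
      _ < c₀ := by linarith
  have h2δ₀M : 2 * δ₀ ≤ δ * M⁻¹ := by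
    have h0 : 0 ≤ 4 * δ₀ * M⁻¹ := by positivity
    calc 2 * δ₀ ≤ 4 * δ₀ * (M * M⁻¹) + 4 * δ₀ * M⁻¹ := by rw [mul_inv_cancel₀ hM.ne', mul_one]; linarith
      _ = (4 * M + 4) * δ₀ * M⁻¹ := by ring
  refine ⟨δ₀, hδ₀, 1, one_pos, fun a₀ θ₀ u₀ ha hθ hu ha0 hθ0 => ?_⟩
  -- (C) given the profile: S5a, S4′, the clipped reference state, the K-stubs' thresholds at the drifted reference, `σ₀`
  obtain ⟨σ5, hσ5, H5⟩ := hS5a a₀ θ₀ u₀ ha hθ hu ha0 hθ0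
  obtain ⟨σ4, hσ4, H4⟩ := hS4 ηP hηP a₀ θ₀ u₀ ha hθ hu ha0 hθ0
  obtain ⟨x₀, -⟩ : ∃ x₀ : T3, x₀ = 0 := ⟨0, rfl⟩
  set θref : ℝ := max M⁻¹ (min (θ₀ x₀) M) with hθref
  set uref : V3 := (if ‖u₀ x₀‖ ≤ M then u₀ x₀ else 0) with huref
  have hθref1 : M⁻¹ ≤ θref := le_max_left _ _
  have hθref2 : θref ≤ M := max_le (hMi1.trans hM1) (min_le_right _ _)
  have hθref0 : 0 < θref := (inv_pos.2 hM).trans_le hθref1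
  have huM : ‖uref‖ ≤ M := by
    rw [huref]
    split_ifs with h
    · exact h
    · simp [hM.le]
  have hexpδ : Real.exp δ ≤ 3 := (Real.exp_le_exp.2 (by linarith : δ ≤ 1)).trans (Real.exp_one_lt_d9.trans (by norm_num)).le
  have hb1 : M'⁻¹ ≤ 1 * Real.exp δ := by rw [one_mul]; exact hM'i1.trans (Real.one_le_exp hδ.le)
  have hb2 : 1 * Real.exp δ ≤ M' := by rw [one_mul]; linarith
  have hb3 : M'⁻¹ ≤ θref * (1 + 2 * δ) := (hM'iM.trans hθref1).trans (le_mul_of_one_le_right hθref0.le (by linarith))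
  have hb4 : θref * (1 + 2 * δ) ≤ M' :=
    calc θref * (1 + 2 * δ) ≤ M * 2 := mul_le_mul hθref2 (by linarith) (by linarith) hM.le
      _ ≤ M' := by linarith [hM'def]
  have hb5 : ‖uref‖ ≤ M' := huM.trans hMM'
  obtain ⟨σ2, hσ2, HS2σ⟩ := HS2M (1 * Real.exp δ) (θref * (1 + 2 * δ)) uref hb1 hb2 hb3 hb4 hb5
  obtain ⟨σ3, hσ3, HS3σ⟩ := HS3M (1 * Real.exp δ) (θref * (1 + 2 * δ)) uref hb1 hb2 hb3 hb4 hb5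
  set σ₀ : ℝ := min (min (min σ5 σ4) (min σ2 σ3)) (min 1 (ηG / 2)) with hσ₀def
  refine ⟨σ₀, lt_min (lt_min (lt_min hσ5 hσ4) (lt_min hσ2 hσ3)) (lt_min one_pos (half_pos hηG)), ?_⟩
  intro σ hσ hσlt ε n hε hε0 hn T ρ θ u hE hnc Φ
  dsimp only
  intro hP h0 t ht hg
  -- (D) at fixed data: thresholds in `σ`, times, the tie, inversion and identification
  have hσ5' : σ < σ5 := hσlt.trans_le ((min_le_left _ _).trans ((min_le_left _ _).trans (min_le_left _ _)))
  have hσ4' : σ < σ4 := hσlt.trans_le ((min_le_left _ _).trans ((min_le_left _ _).trans (min_le_right _ _)))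
  have hσ2' : σ < σ2 := hσlt.trans_le ((min_le_left _ _).trans ((min_le_right _ _).trans (min_le_left _ _)))
  have hσ3' : σ < σ3 := hσlt.trans_le ((min_le_left _ _).trans ((min_le_right _ _).trans (min_le_right _ _)))
  have hσ1 : σ ≤ 1 := (hσlt.trans_le ((min_le_right _ _).trans (min_le_left _ _))).le
  have hσG : σ < ηG / 2 := hσlt.trans_le ((min_le_right _ _).trans (min_le_right _ _))
  have hσ3 : 0 < σ ^ 3 := pow_pos hσ 3
  have hσ3le : σ ^ 3 ≤ σ := pow_le_of_le_one hσ.le hσ1 three_ne_zero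
  have hn_top : Tendsto n atTop atTop := tendsto_atTop_of_tendsto_mul_pow_three hσ hε hε0 hn
  obtain ⟨htT, ht1⟩ : t < T ∧ t < 1 := ⟨ht.2.trans_le (min_le_left _ _), ht.2.trans_le (min_le_right _ _)⟩
  have htI : t ∈ Ico 0 T := ⟨ht.1, htT⟩
  have h0I : (0 : ℝ) ∈ Ico 0 T := ⟨le_rfl, ht.1.trans_lt htT⟩
  have h0t : (0 : ℝ) ∈ Icc 0 t := ⟨le_rfl, ht.1⟩
  obtain ⟨ubar, θbar, hnc⟩ := hnc
  -- S5a at `σ`: activity inversion; identification of the Euler data at `t = 0` (two LLNs under the same laws)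
  obtain ⟨ρa, hρac, hρa0, hρa1, ⟨c, hc⟩, HLLN⟩ := H5 σ hσ hσ5'
  have ha₀eq : a₀ = fun x => Real.exp c * (ρa x * Real.exp (gChem σ (ρa x))) := by
    funext x; rw [hc x, gChem]; ring
  subst ha₀eq
  obtain ⟨hρ0, hu0, hθ0'⟩ := profiles_eq_of_tendsto
    (P := fun N => particleLaw (Φ N) (canonicalDensity (Torus.geometry (Fin 3)) (ε N) (n N)
      (localGibbsProfile (fun x => Real.exp c * (ρa x * Real.exp (gChem σ (ρa x)))) u₀ θ₀)))
    hP (fun N z χ => empiricalDensityField ((Φ N).flow 0 z) χ) (fun N z χ => empiricalMomentumField ((Φ N).flow 0 z) χ)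
    (fun N z χ => empiricalEnergyField ((Φ N).flow 0 z) χ) hρac hθ hu (hE.smooth_density.isSmooth_slice h0I).continuous
    (hE.smooth_temperature.isSmooth_slice h0I).continuous (hE.smooth_velocity.isSmooth_slice h0I).continuous hρa0
    (fun χ hχ δ' hδ' => HLLN ε n hε hε0 hn Φ hP χ hχ δ' hδ') (fun χ hχ δ' hδ' => h0 χ hχ δ' hδ')
  subst hρ0 hu0 hθ0'
  -- the constant `e^c` drops out of the canonical law
  have hPeq : ∀ N, particleLaw (Φ N) (canonicalDensity (Torus.geometry (Fin 3)) (ε N) (n N)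
      (localGibbsProfile (fun x => Real.exp c * (ρ 0 x * Real.exp (gChem σ (ρ 0 x)))) (u 0) (θ 0))) =
      particleLaw (Φ N) (canonicalDensity (Torus.geometry (Fin 3)) (ε N) (n N)
        (localGibbsProfile (fun x => ρ 0 x * Real.exp (gChem σ (ρ 0 x))) (u 0) (θ 0))) := by
    intro N
    rw [MacroClosureLine.StubLedger.localGibbsProfile_const_mul]
    congr 1
    funext z
    exact KineticWindowGronwallNegative.canonicalDensity_const_mul (Real.exp_pos c).ne' _ _ z
  -- by the guards at time `0`, the clipped reference state IS the Euler state at `x₀`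
  have hg0 := hg 0 h0t x₀
  have hθref_eq : θref = θ 0 x₀ := by rw [hθref, min_eq_left hg0.2.1, max_eq_right hg0.2.2.1]
  have huref_eq : uref = u 0 x₀ := by rw [huref, if_pos hg0.2.2.2.1]
  -- (E) the hypotheses of the dynamic theorem: bands, statics at `0` (LDA), St3, bookkeeping, box, St2′, caps
  have hbandE : ∀ s ∈ Icc 0 t, ∀ x, ρ s x * σ ^ 3 < ηE := fun s hs x => (hg s hs x).1.trans_le hη₀E
  have hmass : ∫ x, ρ 0 x = 1 := hρa1
  obtain ⟨xm, -, hxm⟩ := isCompact_univ.exists_isMinOn univ_nonempty hρac.continuousOn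
  obtain ⟨hπ₀', hm₀i', hm₀'⟩ := HL σ hσ (ρ 0 xm) (hρa0 xm) (ρ 0) hρac
    (fun x => ⟨hxm (mem_univ x), ((hg 0 h0t x).1.le).trans hη₀L⟩) hmass (u 0) (θ 0) hu hθ hθ0 ε n hε hε0 hn
  have hπ₀ : Tendsto (fun N => (n N : ℝ)⁻¹ * Real.log (canonicalPartition (Torus.geometry (Fin 3)) (ε N) (n N)
      (localGibbsProfile (fun x => ρ 0 x * Real.exp (gChem σ (ρ 0 x))) (u 0) (θ 0)))) atTop
      (nhds (∫ x, ρ 0 x * (ρ 0 x * σ ^ 3 * deriv hsExcessFreeEnergy (ρ 0 x * σ ^ 3)))) := by simpa only [gChem] using hπ₀'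
  have hm₀i : ∀ᶠ N : ℕ in atTop, Integrable (fun z => logProfileObs σ ρ θ u 0 z)
      (particleLaw (Φ N) (canonicalDensity (Torus.geometry (Fin 3)) (ε N) (n N)
        (localGibbsProfile (fun x => Real.exp c * (ρ 0 x * Real.exp (gChem σ (ρ 0 x)))) (u 0) (θ 0)))) := by
    simp only [hPeq]; simpa only [logProfileObs_eq_integral, gChem, particleLaw_eq] using hm₀i'
  have hm₀ : Tendsto (fun N => ∫ z, logProfileObs σ ρ θ u 0 z
      ∂(particleLaw (Φ N) (canonicalDensity (Torus.geometry (Fin 3)) (ε N) (n N)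
        (localGibbsProfile (fun x => Real.exp c * (ρ 0 x * Real.exp (gChem σ (ρ 0 x)))) (u 0) (θ 0))))) atTop
      (nhds (∫ x, ρ 0 x * (Real.log (ρ 0 x) + gChem σ (ρ 0 x) - 3 / 2 * Real.log (2 * Real.pi * θ 0 x) - 3 / 2))) := by
    simp only [hPeq]; simpa only [logProfileObs_eq_integral, gChem, particleLaw_eq] using hm₀'
  have hπ : TendstoUniformlyOn (fun N r => (n N : ℝ)⁻¹ * Real.log (canonicalPartition (Torus.geometry (Fin 3)) (ε N) (n N)
      (localGibbsProfile (fun x => ρ r x * Real.exp (gChem σ (ρ r x))) (u r) (θ r))))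
      (fun r => ∫ x, ρ r x * (ρ r x * σ ^ 3 * deriv hsExcessFreeEnergy (ρ r x * σ ^ 3))) atTop (Icc 0 t) := by
    simpa only [gChem] using HSt3 σ hσ ε n hε hε0 hn T ρ θ u hE hmass t htI (fun s hs x => (hg s hs x).1.trans_le hη₀3)
  have hiso := xr_bookkeeping hηE hFa hEqF hσ hE htI hbandE
  obtain ⟨Mb, hMb, hbox⟩ := solution_box hE htI hM
    (fun s hs x => ⟨(hg s hs x).2.1, (hg s hs x).2.2.1, (hg s hs x).2.2.2.1, (hg s hs x).2.2.2.2⟩)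
  obtain ⟨γ, hγ, Hκ⟩ := HSt2 Mb hMb σ hσ ε n hε hε0 hn
  have HSt2' : ∀ κ : ℝ, 0 < κ → ∀ᶠ N : ℕ in atTop, ∀ r ∈ Icc 0 t,
      ∫⁻ w, ENNReal.ofReal (Real.exp (γ * (n N : ℝ) * fluctuationE (mesoRadius (n N)) (ρ r) (θ r) (u r) w))
        ∂(particleLaw (Φ N) (canonicalDensity (Torus.geometry (Fin 3)) (ε N) (n N)
          (localGibbsProfile (fun x => ρ r x * Real.exp (gChem σ (ρ r x))) (u r) (θ r)))) ≤ ENNReal.ofReal (Real.exp (κ * (n N : ℝ))) := by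
    intro κ hκ
    filter_upwards [Hκ κ hκ] with N hN r hr
    have hrT : r ∈ Ico 0 T := ⟨hr.1, hr.2.trans_lt htT⟩
    have key := hN (ρ r) (θ r) (u r) (hE.smooth_density.isSmooth_slice hrT).continuous
      (hE.smooth_temperature.isSmooth_slice hrT).continuous (hE.smooth_velocity.isSmooth_slice hrT).continuous
      ((DenseExcursionEverywhere.integral_density_eq hE hrT).trans hmass) (fun x => ⟨((hbox r hr).1 x).1,
        ((hg r hr x).1.le).trans hη₀S, ((hbox r hr).1 x).2.1, ((hbox r hr).1 x).2.2.1, ((hbox r hr).1 x).2.2.2⟩) (hbox r hr).2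
    simpa only [particleLaw_eq, gChem] using key
  obtain ⟨hcapP, hexpAll⟩ := H4 σ hσ hσ4' ε n hε hε0 hn T ρ θ u hE Φ hP h0 t htI
    (fun s hs x => ((hg s hs x).1.le).trans hη₀P2)
  -- the INTEGRATED exponential cap along the true law: Tonelli along the flow + Markov from the first exponential moment (c″, `b = 1`)
  obtain ⟨A₁, hA₁⟩ := hexpAll 1 one_pos
  simp only [one_mul] at hA₁
  have hcapX : ∀ K' : ℝ, 0 < K' → ∀ᶠ N : ℕ in atTop,
      particleLaw (Φ N) (canonicalDensity (Torus.geometry (Fin 3)) (ε N) (n N)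
        (localGibbsProfile (fun x => Real.exp c * (ρ 0 x * Real.exp (gChem σ (ρ 0 x)))) (u 0) (θ 0)))
        {z | ENNReal.ofReal K' < ∫⁻ r in Set.Icc 0 t,
          ENNReal.ofReal ((n N : ℝ)⁻¹ * ∑ i : Fin (n N), Real.exp ‖((Φ N).flow r z i).2‖)} ≤
      ENNReal.ofReal (t * max A₁ 0 / K') := by
    intro K' hK'
    filter_upwards [hA₁] with N hN
    haveI := hP N
    exact intExpMoment_markov (Φ N) _ (by rw [particleLaw_eq]; exact withDensity_absolutelyContinuous _ _)
      (le_max_right A₁ 0) ht.1 (fun s hs => (hN s hs).trans (ENNReal.ofReal_le_ofReal (le_max_left _ _))) K' hK'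
  have hC₄ : 0 ≤ t * max A₁ 0 := mul_nonneg ht.1 (le_max_right A₁ 0)
  -- the family of exponential velocity moments in mean (c″), with nonnegative constants
  have hexpm : ∀ b : ℝ, 0 < b → ∃ A : ℝ, 0 ≤ A ∧ ∀ᶠ N : ℕ in atTop, ∀ s ∈ Set.Icc 0 t,
      ∫⁻ z, ENNReal.ofReal ((n N : ℝ)⁻¹ * ∑ i : Fin (n N), Real.exp (b * ‖((Φ N).flow s z i).2‖))
        ∂(particleLaw (Φ N) (canonicalDensity (Torus.geometry (Fin 3)) (ε N) (n N)
          (localGibbsProfile (fun x => Real.exp c * (ρ 0 x * Real.exp (gChem σ (ρ 0 x)))) (u 0) (θ 0)))) ≤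
      ENNReal.ofReal A := by
    intro b hb
    obtain ⟨A, hA⟩ := hexpAll b hb
    exact ⟨max A 0, le_max_right _ _, hA.mono fun N hN s hs => (hN s hs).trans (ENNReal.ofReal_le_ofReal (le_max_left _ _))⟩
  -- event import towards the invariant drifted Gibbs law `G_N`: closeness of the tilt to `(1, uref, θref)`
  have htie : ∀ x, |ρ 0 x - 1| ≤ δ₀ := fun x => (hnc x).1
  have hclose : ∀ x, 0 < ρ 0 x * Real.exp (gChem σ (ρ 0 x)) ∧ |Real.log (ρ 0 x * Real.exp (gChem σ (ρ 0 x)) / 1)| ≤ δ ∧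
      ‖u 0 x - uref‖ ≤ δ ∧ |θ 0 x - θref| ≤ δ * θref := by
    intro x
    -- `g_σ(ρ 0 x) = G(ρ 0 x σ³)` with `ρ 0 x σ³ < ηG`, so `|g_σ(ρ 0 x)| < δ₀`; `|log ρ 0 x| ≤ |ρ 0 x − 1|/(1 − |ρ 0 x − 1|) ≤ 2δ₀`
    have hη : ρ 0 x * σ ^ 3 ∈ Ioo 0 ηE := ⟨mul_pos (hρa0 x) hσ3, (hg 0 h0t x).1.trans_le hη₀E⟩
    have hρle : ρ 0 x ≤ 3 / 2 := by linarith [(abs_le.1 (htie x)).2]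
    have hGx := HG (x := ρ 0 x * σ ^ 3) (by
      rw [Real.dist_eq, sub_zero, abs_of_pos hη.1]
      calc ρ 0 x * σ ^ 3 ≤ 3 / 2 * σ ^ 3 := mul_le_mul_of_nonneg_right hρle hσ3.le
        _ ≤ 3 / 2 * σ := by gcongr
        _ < ηG := by linarith)
    have hgx : gChem σ (ρ 0 x) = F (ρ 0 x * σ ^ 3) + ρ 0 x * σ ^ 3 * deriv F (ρ 0 x * σ ^ 3) := by
      rw [gChem, hEqF ⟨hη.1.le, hη.2⟩, deriv_hsExcessFreeEnergy_eq hEqF hη]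
    simp only [hF0, zero_mul, add_zero, Real.dist_eq, sub_zero, ← hgx] at hGx
    have hlx := Real.abs_log_sub_add_sum_range_le (x := 1 - ρ 0 x) (by rw [abs_sub_comm]; linarith [htie x]) 0
    simp only [Finset.range_zero, Finset.sum_empty, zero_add, sub_sub_cancel, pow_one, abs_sub_comm (1 : ℝ)] at hlx
    have hlog : |Real.log (ρ 0 x)| ≤ 2 * δ₀ :=
      calc |Real.log (ρ 0 x)| ≤ |ρ 0 x - 1| / (1 - |ρ 0 x - 1|) := hlx
        _ ≤ δ₀ / (1 / 2) := div_le_div₀ hδ₀.le (htie x) (by norm_num) (by linarith [htie x])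
        _ = 2 * δ₀ := by ring
    refine ⟨mul_pos (hρa0 x) (Real.exp_pos _), ?_, ?_, ?_⟩
    · rw [div_one, Real.log_mul (hρa0 x).ne' (Real.exp_pos _).ne', Real.log_exp]
      linarith [abs_add_le (Real.log (ρ 0 x)) (gChem σ (ρ 0 x))]
    · rw [huref_eq]
      calc ‖u 0 x - u 0 x₀‖ ≤ ‖u 0 x - ubar‖ + ‖u 0 x₀ - ubar‖ := by
            rw [norm_sub_rev (u 0 x₀) ubar]; exact norm_sub_le_norm_sub_add_norm_sub _ _ _
        _ ≤ δ := by linarith [(hnc x).2.1, (hnc x₀).2.1]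
    · rw [hθref_eq]
      calc |θ 0 x - θ 0 x₀| ≤ |θ 0 x - θbar| + |θ 0 x₀ - θbar| := by rw [abs_sub_comm (θ 0 x₀) θbar]; exact abs_sub_le _ _ _
        _ ≤ δ * M⁻¹ := by linarith [(hnc x).2.2, (hnc x₀).2.2]
        _ ≤ δ * θ 0 x₀ := mul_le_mul_of_nonneg_left hg0.2.2.1 hδ.le
  have hac : Continuous fun x => ρ 0 x * Real.exp (gChem σ (ρ 0 x)) := by
    have h : (fun x => ρ 0 x * Real.exp (gChem σ (ρ 0 x))) =
        fun x => (Real.exp c)⁻¹ * (Real.exp c * (ρ 0 x * Real.exp (gChem σ (ρ 0 x)))) := by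
      funext x; rw [← mul_assoc, inv_mul_cancel₀ (Real.exp_pos c).ne', one_mul]
    rw [h]; exact continuous_const.mul ha
  have hImp : ∀ N (S : Set (Config (n N) (Fin 3) T3)),
      particleLaw (Φ N) (canonicalDensity (Torus.geometry (Fin 3)) (ε N) (n N)
        (localGibbsProfile (fun x => Real.exp c * (ρ 0 x * Real.exp (gChem σ (ρ 0 x)))) (u 0) (θ 0))) S ≤
      ENNReal.ofReal (Real.exp (C * δ * (n N))) * particleLaw (Φ N) (canonicalDensity (Torus.geometry (Fin 3)) (ε N) (n N)
          (localGibbsProfile (fun _ => 1 * Real.exp δ) (fun _ => uref) (fun _ => θref * (1 + 2 * δ)))) S := by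
    intro N S
    rw [hPeq N]
    exact HTD δ hδ hδhalf 1 θref uref hM'i1 hM'1 (hM'iM.trans hθref1) (hθref2.trans hMM') hb5
      (fun x => ρ 0 x * Real.exp (gChem σ (ρ 0 x))) (θ 0) (u 0) hac hθ hu hclose (ε N) (hε N) (n N) (Φ N) S
  -- the K-stubs at `G_N` (rates weakened from `c₂, c₃` to `c₀`), and the dynamic theorem at these data
  have hrate : ∀ {c' : ℝ}, c₀ ≤ c' → ∀ N : ℕ,
      ENNReal.ofReal (Real.exp (-(c' * (n N : ℝ)))) ≤ ENNReal.ofReal (Real.exp (-(c₀ * (n N : ℝ)))) := fun hc' N =>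
    ENNReal.ofReal_le_ofReal (Real.exp_le_exp.2 (neg_le_neg (mul_le_mul_of_nonneg_right hc' (Nat.cast_nonneg _))))
  have key := hdyn hηE hFa hEqF hσ hE htI ht1 hbandE hmass hηP hηPE hn_top hε Φ
    (fun N => particleLaw (Φ N) (canonicalDensity (Torus.geometry (Fin 3)) (ε N) (n N)
      (localGibbsProfile (fun x => Real.exp c * (ρ 0 x * Real.exp (gChem σ (ρ 0 x)))) (u 0) (θ 0))))
    hPeq hP hπ₀ hπ hm₀ hm₀i hiso hγ HSt2' hcapP hC₄ hcapX hexpm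
    (fun N => particleLaw (Φ N) (canonicalDensity (Torus.geometry (Fin 3)) (ε N) (n N)
      (localGibbsProfile (fun _ => 1 * Real.exp δ) (fun _ => uref) (fun _ => θref * (1 + 2 * δ)))))
    hCδ hImp hηPK2 hηPK3
    (fun K' hK' s τ hs hτ hst ψ hψ hψb δ' hδ' =>
      (HS2σ σ hσ hσ2' ε n hε hε0 hn Φ s τ hs hτ hst ψ hψ hψb δ' hδ' K' hK').mono fun N hN => hN.trans (hrate hc₀2 N))
    (fun K' hK' s τ hs hτ hst φ hφ hφb δ' hδ' =>
      (HS3σ σ hσ hσ3' ε n hε hε0 hn Φ s τ hs hτ hst φ hφ hφb δ' hδ' K' hK').mono fun N hN => hN.trans (hrate hc₀3 N))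
  -- `logProfileObs_eq_integral` identifies the conclusion with the `let Λ` of `OneMeanLowerBound`
  exact fun κ hκ => (key κ hκ).mono fun N hN => by simpa only [logProfileObs_eq_integral, gChem] using hN


end Summit.AtomisticToContinuum.HydrodynamicLimit.Theorems.NearConstantShortTimeHL

end
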